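import Summits.BirchSwinnertonDyer.BirchSwinnertonDyer.Theses.PrintX8VS
import Summits.BirchSwinnertonDyer.BirchSwinnertonDyer.Theorems.PrintX8VSInputHondaSystem
import Summits.BirchSwinnertonDyer.BirchSwinnertonDyer.Theorems.SignedLowerHalvesSharpFlatCharValueRankZeroAllLevelsOfPoitouTate
import Literature.NumberTheory.EllipticCurves.AnalyticRankModularityProofs
import Literature.NumberTheory.EllipticCurves.SkinnerUrban2014.PAdicUnitPeriodRatioProofs
import HarnessLib

/-!
# Route `PrintX8VS`, support items `PublishedInputsX8Core` (stmt-BirchSwinnertonDyer-23004) and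
# `PublishedInputsX8` (stmt-BirchSwinnertonDyer-20403): the SLIMMED dependency lists, second pass —
# Sprung 2012 Thm. 2.2 (child `InputHondaSystem`, item 20413) is now a THEOREM of the tree, and
# Sprung 2024 Lemma 5.9 all-`N` (child `InputLem59AllN`, item 19878) is REPLACED by two generic
# Poitou–Tate duality rows over `ℚ`

D-0154 (2) INPUTS→UNCONDITIONAL, `INPUTS-LIST-2.md` §4 T1 «PackSlim», second pass (cell `pub/bsd-wall`,
desk `bsd-inputs`, seat `bsd-inputs-pack-p1` g2); sequel of (but not importing) the first pass
`PrintX8VSPublishedInputsX8CoreSlim.lean` (g0, p610229: `publishedInputsX8Core_of_slim`, 7 → 6 children by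
dropping the entire continuation; `publishedInputsX8Core_of_slim_lem55`, Lemma 5.9 ⟸ its single residual
Lemma 5.5). Two things moved since:

1. **Sprung 2012 Thm. 2.2 is PROVED** (INPUTS seat `honda-p1`, 18 files `PrintX8VSInputHondaSystem*`,
   closing file p618507): `Theorems.thm22_exists_isHondaSystem_holds :
   Sprung2012.thm22_exists_isHondaSystem` and, by name, `Theorems.InputHondaSystem_proof :
   PrintX8VS.InputHondaSystem` — item 20413 is CLOSED (proved); conjunct 3 of the pack is no longer an
   input.
2. **Sprung 2024 §5.2 Lemmas 5.5 · 5.8 · 5.9 for every conductor** (`InputLem59AllN` :=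
   `Sprung2024.lem59AllN_sharpFlatCharValue_rankZero`, the ♯/♭ `Γ`-Euler characteristic in analytic
   rank `0` as attributed by Ray–Sprung 2025 p. 2343, a composite carrying the flag
   `Sprung24-§5.2-allN-via-RaySprung25`) is a THEOREM modulo two GENERIC class-field-theory duality
   statements over `ℚ` (INPUTS seats `l55-p1` / `k4-p1`, p618145
   `SignedLowerHalvesSharpFlatCharValueRankZeroAllLevelsOfPoitouTate.lean`):
   `SharpFlatCount.lem59AllN_of_poitouTate :
     poitouTate_selmerStructure_duality ℚ → poitouTate_sha_tateDual ℚ → Sprung2024.lem59AllN_…`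
   (Cassels' surjectivity ⟸ Poitou–Tate for Selmer structures, Milne ADT I Thm. 4.10 / Howard 2.1.11;
   `Ш²(ℚ, E[p^∞]) = ⊥` at an odd supersingular `p` with `Sel_{p^∞}(E/ℚ)` finite ⟸ Milne ADT I
   Thm. 4.10 (a) alone, via `cd_p(Γ_ℚ) ≤ 2` and `2·H²(ℝ, ·) = 0`; then the coinvariant count of Lemma 5.5
   over the Honda-system local lift and the discharged Coleman surjectivities Sprung 2012 Props. 7.3 /
   7.6), with the Cassels-keyed variant `SharpFlatCount.lem59AllN_of_cassels_of_poitouTate :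
   Greenberg1999.casselsSurjectivity_H1Sigma ℚ → poitouTate_sha_tateDual ℚ → …` (Greenberg LNM 1716
   Prop. 4.13 kept by name).

Hence, BY NAME for route `PrintX8VS` (every remaining hypothesis a registered item of the route or a
named generic fact):
* §1 `printX8VS_inputLem59AllN_of_poitouTate` / `…_of_cassels_of_poitouTate` — the child
  `InputLem59AllN` (19878) from the two rows;
* §2 `publishedInputsX8Core_of_open` — **`PublishedInputsX8Core` (23004) ⟸ its FIVE still-OPEN
  children** `InputBKOCorA5SharpFlat` (20412), `InputNewform` (19382), `InputSharpFlatTorsion` (20414),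
  `InputKatoSharpFlatDivisibility` (20415), `InputLem59AllN` (19878) (7 → 5: the Honda child is the
  theorem `InputHondaSystem_proof`, the entire continuation follows from the newform);
  `publishedInputsX8Core_of_slim_poitouTate` — **`PublishedInputsX8Core` ⟸ FOUR print children
  (20412, 19382, 20414, 20415) + the two generic rows** (7 displayed conjuncts ⟸ 4 elliptic-curve
  print inputs + 2 generic CFT inputs; the first pass had 6 print inputs, one of them the flagged
  composite); `…_of_slim_cassels_poitouTate` — the same keyed on Prop. 4.13;
* §3 `publishedInputsX8_of_open`, `publishedInputsX8_of_slim_poitouTate`,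
  `publishedInputsX8_of_slim_period_poitouTate` — the eight-conjunct bundle `PublishedInputsX8` (20403)
  likewise (period unit at `3` kept as the registered child `InputPeriodUnitThree` 19291, resp. from
  Mazur 1978 Cor. 4.1 by `SkinnerUrban2014.realPeriodRat_eq_unit_mul_plusPeriod_three_of_mazur`).

NET EFFECT ON THE INPUT LEDGER (rows 7/8): under pack 23004 the displayed base
{BKO A.5 (♯/♭), Modularity, Sprung 2012 Thm. 2.2, Thm. 7.14, Thm. 7.16, Sprung 2024 L5.9 all-`N`, entireness}
becomes {BKO A.5 (♯/♭), Modularity, Sprung 2012 Thm. 7.14, Thm. 7.16} + {PT-Sel (or Greenberg Prop. 4.13),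
PT-Ш} — the latter the SAME two generic rows that rows 1 / 6 / 8 rest on
(`SSFlatEC.flatCountTwo_of_poitouTate_all`, `SharpFlatCount.sharpFlatCharValueRankZeroAllLevels_of_poitouTate`).
HONEST FRAMING: pure glue over landed theorems; CONDITIONAL on the listed hypotheses (the four children
are refereed print inputs about elliptic curves — two of them, Sprung 2012 Thms. 7.14 / 7.16, rest on
Kato's Euler system; the two rows are generic CFT duality theorems not proved in the tree); no
cite-only fact is proved HERE (Thm. 2.2 was proved by the Honda series, cited by name); items 23004 /
20403 / 19878 are NOT closed; the route stays conditional on its inputs AS TYPED. Nothing here proves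
BSD; BSD is not proved by any of this.

References: [Sprung2012] Thm. 2.2 (p. 1487), Props. 7.3 / 7.6, Thms. 7.14 / 7.16; [Sprung2024] §5.2
Lemmas 5.5, 5.8, 5.9 and Proof of Thm. 5.3 (pp. 39–41); [RaySprung2025] p. 2343; [MilneADT2006] I
Thm. 4.10, Thm. 6.13; [GreenbergLNM1716] §4 Prop. 4.13 / p. 122; [Howard2004HeegnerKolyvagin] Thm. 2.1.11;
[Kobayashi2003] §8; [Mazur1978] Cor. 4.1; [DiamondShurman2005] Thm. 8.8.3.
-/

set_option autoImplicit false
-- the Theorems namespace of this sub repeats the summit name by design (D-0017 nested layout)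
set_option linter.dupNamespace false

namespace Summit.BirchSwinnertonDyer.BirchSwinnertonDyer.Theorems

open Literature.NumberTheory.EllipticCurves Literature.NumberTheory.GaloisCohomology
open Summit.BirchSwinnertonDyer.BirchSwinnertonDyer.Theses.PrintX8VS

/-! ## §1 The child `InputLem59AllN` (item 19878) BY NAME from the two generic rows -/

/-- **Route `PrintX8VS`, child `InputLem59AllN` (stmt-BirchSwinnertonDyer-19878 = Sprung 2024 §5.2
Lemmas 5.5 · 5.8 · 5.9 all-`N`) ⟸ the TWO generic Poitou–Tate rows over `ℚ`**
(`poitouTate_selmerStructure_duality ℚ`, Milne ADT I Thm. 4.10 / Howard 2.1.11, and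
`poitouTate_sha_tateDual ℚ`, Milne ADT I Thm. 4.10 (a)): the route decl has the body of the named fact,
served by `SharpFlatCount.lem59AllN_of_poitouTate` (p618145). CONDITIONAL on the two rows; does not
close the item. [cite: Sprung2024, §5.2 Lemmas 5.5, 5.8, 5.9 (pp. 40–41)] [cite: RaySprung2025, p. 2343]
[cite: MilneADT2006, Ch. I, Thm. 4.10] -/
theorem printX8VS_inputLem59AllN_of_poitouTate (hPTs : poitouTate_selmerStructure_duality ℚ)
    (hPT : poitouTate_sha_tateDual ℚ) :
    Summit.BirchSwinnertonDyer.BirchSwinnertonDyer.Theses.PrintX8VS.InputLem59AllN :=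
  SharpFlatCount.lem59AllN_of_poitouTate hPTs hPT

/-- **Route `PrintX8VS`, child `InputLem59AllN` (19878) ⟸ CASSELS' surjectivity (Greenberg LNM 1716
Prop. 4.13, `Greenberg1999.casselsSurjectivity_H1Sigma ℚ`, kept by name) + the ONE generic row
`poitouTate_sha_tateDual ℚ`** (`SharpFlatCount.lem59AllN_of_cassels_of_poitouTate`). CONDITIONAL; does
not close the item. [cite: Sprung2024, §5.2 (pp. 39–41)] [cite: GreenbergLNM1716, §4 Prop. 4.13 / p. 122]
[cite: MilneADT2006, Ch. I, Thm. 4.10 (a)] -/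
theorem printX8VS_inputLem59AllN_of_cassels_of_poitouTate
    (hC : Greenberg1999.casselsSurjectivity_H1Sigma ℚ) (hPT : poitouTate_sha_tateDual ℚ) :
    Summit.BirchSwinnertonDyer.BirchSwinnertonDyer.Theses.PrintX8VS.InputLem59AllN :=
  SharpFlatCount.lem59AllN_of_cassels_of_poitouTate hC hPT

/-! ## §2 `PublishedInputsX8Core` (item 23004) -/

/-- **`PublishedInputsX8Core` from its FIVE still-open children, BY NAME** (route `PrintX8VS`, item
stmt-BirchSwinnertonDyer-23004; INPUTS-LIST-2 T1 «PackSlim», second pass): `InputBKOCorA5SharpFlat`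
(20412), `InputNewform` (19382), `InputSharpFlatTorsion` (20414), `InputKatoSharpFlatDivisibility`
(20415) and `InputLem59AllN` (19878) imply the seven-conjunct pack — conjunct 3 (Sprung 2012 Thm. 2.2,
`InputHondaSystem`, item 20413 CLOSED) is the tree theorem `InputHondaSystem_proof` (p618507), conjunct
7 (entireness of `L(E,s)`) is `WeierstrassCurve.hasEntireLFunction_rat_of_exists_isNewformOf`
(Diamond–Shurman Thm. 8.8.3 ⇒ 5.10.2) applied to conjunct 2. Every hypothesis is a registered item;
pure glue; nothing is closed here. [cite: Sprung2012, Thm. 2.2 (p. 1487)]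
[cite: DiamondShurman2005, Thm. 8.8.3] -/
theorem publishedInputsX8Core_of_open
    (hBKO : InputBKOCorA5SharpFlat) (hmod : InputNewform) (hTors : InputSharpFlatTorsion)
    (hKato : InputKatoSharpFlatDivisibility) (h59 : InputLem59AllN) :
    Summit.BirchSwinnertonDyer.BirchSwinnertonDyer.Theses.PrintX8VS.PublishedInputsX8Core :=
  ⟨hBKO, hmod, InputHondaSystem_proof, hTors, hKato, h59,
    WeierstrassCurve.hasEntireLFunction_rat_of_exists_isNewformOf hmod⟩

/-- **`PublishedInputsX8Core` from FOUR print children and the TWO generic Poitou–Tate rows over `ℚ`,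
BY NAME** (item stmt-BirchSwinnertonDyer-23004): the registered children `InputBKOCorA5SharpFlat`
(20412), `InputNewform` (19382), `InputSharpFlatTorsion` (20414), `InputKatoSharpFlatDivisibility`
(20415), together with `poitouTate_selmerStructure_duality ℚ` and `poitouTate_sha_tateDual ℚ`, imply
the seven-conjunct pack: conjunct 3 (Honda system) is the theorem `InputHondaSystem_proof`, conjunct 6
(`InputLem59AllN`, Sprung 2024 L5.9 all-`N`) is `SharpFlatCount.lem59AllN_of_poitouTate`, conjunct 7
(entireness) follows from the newform. Pure glue; the six hypotheses remain inputs (four refereed print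
facts about elliptic curves, two generic class-field-theory duality statements); nothing is closed.
[cite: Sprung2024, §5.2 (pp. 39–41)] [cite: MilneADT2006, Ch. I, Thm. 4.10] [cite: Sprung2012, Thm. 2.2 (p. 1487)] -/
theorem publishedInputsX8Core_of_slim_poitouTate
    (hBKO : InputBKOCorA5SharpFlat) (hmod : InputNewform) (hTors : InputSharpFlatTorsion)
    (hKato : InputKatoSharpFlatDivisibility)
    (hPTs : poitouTate_selmerStructure_duality ℚ) (hPT : poitouTate_sha_tateDual ℚ) :
    Summit.BirchSwinnertonDyer.BirchSwinnertonDyer.Theses.PrintX8VS.PublishedInputsX8Core :=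
  publishedInputsX8Core_of_open hBKO hmod hTors hKato
    (printX8VS_inputLem59AllN_of_poitouTate hPTs hPT)

/-- **`PublishedInputsX8Core` from four print children, CASSELS' surjectivity (Greenberg Prop. 4.13, by
name) and the one generic row `poitouTate_sha_tateDual ℚ`** — the variant of
`publishedInputsX8Core_of_slim_poitouTate` for pens that display Prop. 4.13 rather than Poitou–Tate for
Selmer structures. Pure glue; nothing is closed. [cite: GreenbergLNM1716, §4 Prop. 4.13 / p. 122]
[cite: MilneADT2006, Ch. I, Thm. 4.10 (a)] -/
theorem publishedInputsX8Core_of_slim_cassels_poitouTate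
    (hBKO : InputBKOCorA5SharpFlat) (hmod : InputNewform) (hTors : InputSharpFlatTorsion)
    (hKato : InputKatoSharpFlatDivisibility)
    (hC : Greenberg1999.casselsSurjectivity_H1Sigma ℚ) (hPT : poitouTate_sha_tateDual ℚ) :
    Summit.BirchSwinnertonDyer.BirchSwinnertonDyer.Theses.PrintX8VS.PublishedInputsX8Core :=
  publishedInputsX8Core_of_open hBKO hmod hTors hKato
    (printX8VS_inputLem59AllN_of_cassels_of_poitouTate hC hPT)

/-! ## §3 `PublishedInputsX8` (item 20403): the eight-conjunct bundle likewise -/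

/-- **`PublishedInputsX8` (item 20403) from its SIX still-open children** (the five of
`publishedInputsX8Core_of_open` and the period child `InputPeriodUnitThree`, 19291): the Honda conjunct
is `InputHondaSystem_proof`, entireness follows from the newform. Pure glue; nothing is closed.
[cite: Sprung2012, Thm. 2.2 (p. 1487)] [cite: DiamondShurman2005, Thm. 8.8.3] -/
theorem publishedInputsX8_of_open
    (hBKO : InputBKOCorA5SharpFlat) (hmod : InputNewform) (hTors : InputSharpFlatTorsion)
    (hKato : InputKatoSharpFlatDivisibility) (h59 : InputLem59AllN) (hPer3 : InputPeriodUnitThree) :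
    Summit.BirchSwinnertonDyer.BirchSwinnertonDyer.Theses.PrintX8VS.PublishedInputsX8 :=
  ⟨hBKO, hmod, InputHondaSystem_proof, hTors, hKato, h59, hPer3,
    WeierstrassCurve.hasEntireLFunction_rat_of_exists_isNewformOf hmod⟩

/-- **`PublishedInputsX8` (item 20403) from four print children, Mazur 1978 Cor. 4.1 and the two generic
rows**: the core as in `publishedInputsX8Core_of_slim_poitouTate`; conjunct 7 (the period unit at `3`)
from `ModularForms.mazur_not_dvd_maninConstant_of_odd` by
`SkinnerUrban2014.realPeriodRat_eq_unit_mul_plusPeriod_three_of_mazur`; conjunct 8 (entireness) from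
the newform. Pure glue; nothing is closed. [cite: Mazur1978, Cor. 4.1]
[cite: Sprung2024, §5.2 (pp. 39–41)] [cite: MilneADT2006, Ch. I, Thm. 4.10] -/
theorem publishedInputsX8_of_slim_poitouTate
    (hBKO : InputBKOCorA5SharpFlat) (hmod : InputNewform) (hTors : InputSharpFlatTorsion)
    (hKato : InputKatoSharpFlatDivisibility)
    (hMazur : ModularForms.mazur_not_dvd_maninConstant_of_odd)
    (hPTs : poitouTate_selmerStructure_duality ℚ) (hPT : poitouTate_sha_tateDual ℚ) :
    Summit.BirchSwinnertonDyer.BirchSwinnertonDyer.Theses.PrintX8VS.PublishedInputsX8 :=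
  publishedInputsX8_of_open hBKO hmod hTors hKato (printX8VS_inputLem59AllN_of_poitouTate hPTs hPT)
    (SkinnerUrban2014.realPeriodRat_eq_unit_mul_plusPeriod_three_of_mazur hMazur)

/-- **`PublishedInputsX8` (item 20403) from five registered children and the two generic rows** (keep the
period child `InputPeriodUnitThree` 19291; drop Honda, Lemma 5.9 and the entire continuation).
Pure glue; nothing is closed. [cite: Sprung2024, §5.2 (pp. 39–41)] [cite: MilneADT2006, Ch. I, Thm. 4.10] -/
theorem publishedInputsX8_of_slim_period_poitouTate
    (hBKO : InputBKOCorA5SharpFlat) (hmod : InputNewform) (hTors : InputSharpFlatTorsion)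
    (hKato : InputKatoSharpFlatDivisibility) (hPer3 : InputPeriodUnitThree)
    (hPTs : poitouTate_selmerStructure_duality ℚ) (hPT : poitouTate_sha_tateDual ℚ) :
    Summit.BirchSwinnertonDyer.BirchSwinnertonDyer.Theses.PrintX8VS.PublishedInputsX8 :=
  publishedInputsX8_of_open hBKO hmod hTors hKato (printX8VS_inputLem59AllN_of_poitouTate hPTs hPT)
    hPer3

end Summit.BirchSwinnertonDyer.BirchSwinnertonDyer.Theorems
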